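import Mathlib
import Summits.AnomalousDissipation.AnomalousDissipation.Theorems.SolenoidalFractalHomogenisationLagrangianStepW7EngineSpine
import HarnessLib

/-!
# K1L_D (stmt-AnomalousDissipation-27980), registry v8 — W7 ENGINE, SCALAR SPINE for ABSOLUTELY CONTINUOUS functionals (a.e. derivatives)
# (helper; `--supports stmt-AnomalousDissipation-27980 --as helper`)

The weak-solution mode calculus (S1a, prover ad-k1l-cellLawV-w1 g4) delivers the chain functionals `E`, `Φ = E + εX` of the W7 engine as
ABSOLUTELY CONTINUOUS functions of time with derivatives ALMOST EVERYWHERE (`AbsolutelyContinuousOnInterval`, `∀ᵐ t, HasDerivAt …`) — an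
everywhere right derivative (as in `…W7EngineSpine.gronwall_right_exp`) is not available for a weak solution.  This file restates §1 of the
scalar spine (p5 g10) in that regularity class; the proofs use Mathlib's fundamental theorem for absolutely continuous functions
(`AbsolutelyContinuousOnInterval.integral_deriv_eq_sub`):
* `le_of_ac_of_ae_deriv_nonpos` — an absolutely continuous function with a.e. nonpositive derivative does not increase;
* `gronwall_ac_exp` — `Φ` AC on `[t₀,t₁]`, `σ` continuous, `Φ' ≤ −σ·Φ` a.e. ⇒ `Φ t₁ ≤ exp(−∫_{t₀}^{t₁} σ)·Φ t₀`;
* `slot_contraction_ac`, `slot_contraction_ac_of_nonneg` — the ramped-slot contraction with NO prefactor (`Φ = E` at both slot ends,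
  `c₁E ≤ Φ ≤ c₂E`, `Φ' ≤ −ρE` a.e.) in the AC class: `E t₁ ≤ exp(−∫ min(ρ/c₂, ρ/c₁))·E t₀`.
W7 assembly owner: prover ad-sawtooth-k1loc-p1 g11 (S1b); spine of record: p5 g10.  NOT a proof of the crux / of AD; rung F-D1.A0.
[cite: BedrossianCotiZelati2017, §2 (Grönwall on an equivalent hypocoercivity functional)] [problem: turb]
-/

set_option linter.dupNamespace false

namespace Summit.AnomalousDissipation.AnomalousDissipation.Theorems.SolenoidalFractalHomogenisation.LagrangianStep.W7Engine

open Set Real MeasureTheory intervalIntegral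

/-- An absolutely continuous function on `[t₀, t₁]` whose derivative is `≤ 0` almost everywhere does not increase:
`G t₁ ≤ G t₀`. [cite: BedrossianCotiZelati2017, §2] -/
theorem le_of_ac_of_ae_deriv_nonpos {G g : ℝ → ℝ} {t₀ t₁ : ℝ} (ht : t₀ ≤ t₁)
    (hG : AbsolutelyContinuousOnInterval G t₀ t₁)
    (hGd : ∀ᵐ t, t ∈ uIcc t₀ t₁ → HasDerivAt G (g t) t) (hg : ∀ᵐ t, t ∈ uIcc t₀ t₁ → g t ≤ 0) :
    G t₁ ≤ G t₀ := by
  have hFTC := hG.integral_deriv_eq_sub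
  -- `deriv G = g ≤ 0` a.e. on the interval
  have hle : ∫ x in t₀..t₁, deriv G x ≤ 0 := by
    have hae : ∀ᵐ x ∂volume, x ∈ Icc t₀ t₁ → deriv G x ≤ 0 := by
      filter_upwards [hGd, hg] with x hx1 hx2 hx
      rw [uIcc_of_le ht] at hx1 hx2
      rw [(hx1 hx).deriv]; exact hx2 hx
    have hneg : 0 ≤ ∫ x in t₀..t₁, -deriv G x := by
      apply intervalIntegral.integral_nonneg_of_ae_restrict ht
      rw [Filter.EventuallyLE, ae_restrict_iff' measurableSet_Icc]
      filter_upwards [hae] with x hx hxI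
      simpa using hx hxI
    rw [intervalIntegral.integral_neg] at hneg
    linarith
  linarith

/-- **Grönwall for an absolutely continuous functional with an a.e. derivative bound.**  If `Φ` is absolutely continuous on `[t₀, t₁]`,
`σ` is continuous, and for a.e. `t ∈ [t₀, t₁]` `Φ` has derivative `φ t ≤ −σ t · Φ t`, then `Φ t₁ ≤ exp(−∫_{t₀}^{t₁} σ)·Φ t₀`.
[cite: BedrossianCotiZelati2017, §2] -/
theorem gronwall_ac_exp {Φ φ σ : ℝ → ℝ} {t₀ t₁ : ℝ} (ht : t₀ ≤ t₁)
    (hΦ : AbsolutelyContinuousOnInterval Φ t₀ t₁)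
    (hΦd : ∀ᵐ t, t ∈ uIcc t₀ t₁ → HasDerivAt Φ (φ t) t)
    (hσ : Continuous σ) (hineq : ∀ᵐ t, t ∈ uIcc t₀ t₁ → φ t ≤ -σ t * Φ t) :
    Φ t₁ ≤ Real.exp (-∫ s in t₀..t₁, σ s) * Φ t₀ := by
  set I : ℝ → ℝ := fun t => ∫ s in t₀..t, σ s with hI
  have hId : ∀ t, HasDerivAt I (σ t) t := fun t => (hσ.integral_hasStrictDerivAt t₀ t).hasDerivAt
  -- `exp ∘ I` is `C¹`, hence absolutely continuous on the interval
  have hexpd : ∀ t, HasDerivAt (fun s => Real.exp (I s)) (Real.exp (I t) * σ t) t :=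
    fun t => (Real.hasDerivAt_exp (I t)).comp t (hId t)
  have hIc : Continuous I := continuous_iff_continuousAt.2 fun t => (hId t).continuousAt
  have hexpC1 : ContDiff ℝ 1 (fun s => Real.exp (I s)) := by
    rw [contDiff_one_iff_deriv]
    refine ⟨fun t => (hexpd t).differentiableAt, ?_⟩
    have hd : deriv (fun s => Real.exp (I s)) = fun t => Real.exp (I t) * σ t := funext fun t => (hexpd t).deriv
    rw [hd]
    exact (Real.continuous_exp.comp hIc).mul hσ
  have hexpAC : AbsolutelyContinuousOnInterval (fun s => Real.exp (I s)) t₀ t₁ :=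
    (hexpC1.contDiffOn (s := uIcc t₀ t₁)).absolutelyContinuousOnInterval
  set G : ℝ → ℝ := fun t => Real.exp (I t) * Φ t with hG
  have hGAC : AbsolutelyContinuousOnInterval G t₀ t₁ := hexpAC.fun_mul hΦ
  have hGd : ∀ᵐ t, t ∈ uIcc t₀ t₁ → HasDerivAt G (Real.exp (I t) * σ t * Φ t + Real.exp (I t) * φ t) t := by
    filter_upwards [hΦd] with t ht htI
    exact (hexpd t).mul (ht htI)
  have hGle : ∀ᵐ t, t ∈ uIcc t₀ t₁ → Real.exp (I t) * σ t * Φ t + Real.exp (I t) * φ t ≤ 0 := by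
    filter_upwards [hineq] with t ht htI
    have h := ht htI
    have hpos : 0 < Real.exp (I t) := Real.exp_pos _
    nlinarith
  have key := le_of_ac_of_ae_deriv_nonpos ht hGAC hGd hGle
  have hI0 : I t₀ = 0 := by simp [hI]
  have hG0 : G t₀ = Φ t₀ := by simp [hG, hI0]
  rw [hG0] at key
  have hpos : 0 < Real.exp (-I t₁) := Real.exp_pos _
  have h2 : Real.exp (-I t₁) * (Real.exp (I t₁) * Φ t₁) ≤ Real.exp (-I t₁) * Φ t₀ :=
    mul_le_mul_of_nonneg_left key hpos.le
  calc Φ t₁ = Real.exp (-I t₁) * (Real.exp (I t₁) * Φ t₁) := by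
          rw [← mul_assoc, ← Real.exp_add]; simp
    _ ≤ Real.exp (-I t₁) * Φ t₀ := h2

/-- **Slot contraction with NO prefactor, absolutely continuous form.**  A functional `Φ`, absolutely continuous on `[t₀, t₁]`, with
a.e. derivative `φ ≤ −ρ(t)·E`, sandwiched `c₁E ≤ Φ ≤ c₂E` (`0 < c₁ ≤ c₂`) on the interval, `ρ` continuous of any sign, and `Φ = E` at
both slot ends, gives `E t₁ ≤ exp(−∫_{t₀}^{t₁} min(ρ/c₂, ρ/c₁))·E t₀`. [cite: BedrossianCotiZelati2017, §2] -/
theorem slot_contraction_ac {E Φ φ ρ : ℝ → ℝ} {t₀ t₁ c₁ c₂ : ℝ} (ht : t₀ ≤ t₁) (hc₁ : 0 < c₁) (hc₁₂ : c₁ ≤ c₂)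
    (hΦ : AbsolutelyContinuousOnInterval Φ t₀ t₁)
    (hΦd : ∀ᵐ t, t ∈ uIcc t₀ t₁ → HasDerivAt Φ (φ t) t)
    (hρ : Continuous ρ) (hineq : ∀ᵐ t, t ∈ uIcc t₀ t₁ → φ t ≤ -ρ t * E t)
    (hlo : ∀ t ∈ Icc t₀ t₁, c₁ * E t ≤ Φ t) (hhi : ∀ t ∈ Icc t₀ t₁, Φ t ≤ c₂ * E t)
    (h0 : Φ t₀ = E t₀) (h1 : Φ t₁ = E t₁) :
    E t₁ ≤ Real.exp (-∫ s in t₀..t₁, min (ρ s / c₂) (ρ s / c₁)) * E t₀ := by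
  have hσ : Continuous fun s => min (ρ s / c₂) (ρ s / c₁) := (hρ.div_const _).min (hρ.div_const _)
  have hineq' : ∀ᵐ t, t ∈ uIcc t₀ t₁ → φ t ≤ -(min (ρ t / c₂) (ρ t / c₁)) * Φ t := by
    filter_upwards [hineq] with t hφ htI
    have htI' : t ∈ Icc t₀ t₁ := by rwa [uIcc_of_le ht] at htI
    exact rate_transfer hc₁ hc₁₂ (hlo t htI') (hhi t htI') (hφ htI)
  have := gronwall_ac_exp ht hΦ hΦd hσ hineq'
  rw [h0, h1] at this
  exact this

/-- The `ρ ≥ 0` form of `slot_contraction_ac`: `E t₁ ≤ exp(−(1/c₂)∫_{t₀}^{t₁} ρ)·E t₀`. [cite: BedrossianCotiZelati2017, §2] -/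
theorem slot_contraction_ac_of_nonneg {E Φ φ ρ : ℝ → ℝ} {t₀ t₁ c₁ c₂ : ℝ} (ht : t₀ ≤ t₁) (hc₁ : 0 < c₁) (hc₁₂ : c₁ ≤ c₂)
    (hΦ : AbsolutelyContinuousOnInterval Φ t₀ t₁)
    (hΦd : ∀ᵐ t, t ∈ uIcc t₀ t₁ → HasDerivAt Φ (φ t) t)
    (hρ : Continuous ρ) (hρ0 : ∀ t, 0 ≤ ρ t) (hineq : ∀ᵐ t, t ∈ uIcc t₀ t₁ → φ t ≤ -ρ t * E t)
    (hlo : ∀ t ∈ Icc t₀ t₁, c₁ * E t ≤ Φ t) (hhi : ∀ t ∈ Icc t₀ t₁, Φ t ≤ c₂ * E t)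
    (h0 : Φ t₀ = E t₀) (h1 : Φ t₁ = E t₁) :
    E t₁ ≤ Real.exp (-((1 / c₂) * ∫ s in t₀..t₁, ρ s)) * E t₀ := by
  have hc₂ : 0 < c₂ := lt_of_lt_of_le hc₁ hc₁₂
  have h := slot_contraction_ac ht hc₁ hc₁₂ hΦ hΦd hρ hineq hlo hhi h0 h1
  have hmin : ∀ s, min (ρ s / c₂) (ρ s / c₁) = ρ s / c₂ := fun s =>
    min_eq_left (div_le_div_of_nonneg_left (hρ0 s) hc₁ hc₁₂)
  simp_rw [hmin] at h
  have hint : ∫ s in t₀..t₁, ρ s / c₂ = (1 / c₂) * ∫ s in t₀..t₁, ρ s := by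
    rw [← intervalIntegral.integral_const_mul]
    congr 1; funext s; ring
  rw [hint] at h
  exact h

end Summit.AnomalousDissipation.AnomalousDissipation.Theorems.SolenoidalFractalHomogenisation.LagrangianStep.W7Engine
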